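/-
Copyright: the b2b-balaban T⁴-continuum CRUX team, row NE7b owner lineage `t4-ne7b-p1` (gen 115). Project licence.
-/
import Summits.QuantumFields.BalabanUV.T4Continuum.Spine.NE7b.SupBackgroundLocalisation
import Literature.MathematicalPhysics.QuantumFieldTheory.Balaban1983to89.B5QGQInverseL2Zd

/-!
# THE NEXT-SCALE PROPAGATOR AT THE BACKGROUND IS EXPONENTIALLY LOCALISED: the coarse operator
# `R(w) = Q′∘(A + N′(σw))∘Dσ(w)` of the perturbed skeleton has the PROPAGATOR FORM
# `R(w)v = (Q′G′Q′*)⁻¹[v + Q′G′(P(N′Dσ(w)v))] + Q′(N′Dσ(w)v)` — the free next-scale inverse covariance `(Q′G′Q′*)⁻¹` plus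
# `O(λ)` weighted-bounded corrections — so every `ℓ^∞` solution of `R(w)u = f` obeys the WEIGHTED A-PRIORI LETTER
# `sup_y e^{μρ(y)}|u(y)| ≤ (1 − λK₁(μ)(C_Q(μ) + 2C_G(μ)))⁻¹·C_Q(μ)·sup_y e^{μρ(y)}|f(y)|`, `C_Q(μ) = cU·K_d(δ_u − μ)` the weighted
# row constant of the block covariance `Q′G′Q′*`: the next-scale propagator reads its source with exponentially small weight far away
# (row NE7b, node U5c; (63) + (62) + (51) + Literature `B5Hk103ScalarZd` ∕ `B6QGQDecay237` BY NAME; [folklore])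

Cell `pub-balaban`, sub-cell `t4`, spine estimate NE7b (`T4WeightBudget.RelWeightBound`; the cell's OWN estimate — NOT PRINTED in
[Bałaban 1983–89], NOT PROVED).  Crux-route work under `Spine/NE7b/` by the row OWNER (`t4-ne7b-p1` gen 115) under FREEZE (0)'s
crux-prover clause (FILING-CLAIM C-ne7bp1-g115-5); NOTHING of Bałaban's is named as a Lean object, valued or asserted; no
`T4Continuum/Support` leaf typed; no `def`, no notation; zero `sorry`.  Imports (BY NAME): the owner's (63) `…SupBackgroundLocalisation`
(`eq_augInverse_of_solution`; through it (62) `weighted_Gop`, `weighted_blockAvg`, `exp_weight_exchange`, `abs_le_exp_neg_mul`,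
`nonneg_of_weighted`, (51) `sum_AX_HBZd`, `sum_AX_fibreInverse`, `summable_mul_Kinv_row`, (49) `abs_tsum_Gk_mul_le_sup`, ASE
`blockAvg_fibreProj`, (58) `abs_apply_le_norm`), the Literature columns `B5Hk103ScalarZd` (`Kinv`, `tsum_mul_tsum_comm`,
`summable_expX`, `tsum_expX_le`), `B5QGQInverseL2Zd` (pv23: `tsum_kerQGQ_mul_Kinv`, the entrywise `Q′G′Q′*·(Q′G′Q′*)⁻¹ = δ` — imported,
not re-proved; located by the gate's dedup on the first filing), `B6QGQLower276` (`kerQGQ`, `sum_B_const`), `B6QGQDecay237`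
(`abs_kerQGQ_le_unif`, `cU`, `cU_pos`, `cInv`, `deltaInv`).

WHY (located).  (65) `…SupNextScaleLocality` made the next-scale linearised equation map `R(w)` bounded on the weighted coarse
spaces and named the INVERSE as «NOT here — the input of the next chart's section».  For the free skeleton `R = Q′AH = (Q′G′Q′*)⁻¹`
((51) `sum_AX_HBZd`), whose inverse is the block covariance `Q′G′Q′*` with pv23's mesh-free row decay (`abs_kerQGQ_le_unif`); at the
background the two perturbation columns are `O(λ)` and weighted-bounded by (62) ∕ (63) (`G′` rows, block averages, diagonals).  So
`R(w)u = f` reads, after one application of `Q′G′Q′*`, as `u = Q′G′Q′*(f − Q′N′Du) − Q′G′P(N′Du)` — a fixed-point form whose weighted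
bootstrap (63)'s pattern closes when `λK₁(μ)(C_Q(μ) + 2C_G(μ)) < 1`.  No operator inverse is constructed: an A-PRIORI letter for
solutions (existence of the next chart is the next level's ASE ∕ SIS business).

WHAT IS PROVED ([folklore]; `ℓ^∞ := lp (fun _ : X d => ℝ) ∞`; weights `ρ` with `ρ x − ρ y ≤ |x − y|`, `|ρ| ≤ M`):
* §1 **`weighted_kerQGQ`** (every `d`, `0 ≤ μ < δ_u`): `e^{μρ(z)}|Σ′_y (Q′G′Q′*)(z,y)f(y)| ≤ cU·K_d(δ_u − μ)·R` whenever
  `e^{μρ(y)}|f(y)| ≤ R` — the block covariance on the weighted coarse space; **`tsum_kerQGQ_Kinv_apply`** (`Q′G′Q′*((Q′G′Q′*)⁻¹m) = m`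
  on bounded `m`, Fubini by `tsum_mul_tsum_comm` + pv23's entrywise `B5QGQInverseL2Zd.tsum_kerQGQ_mul_Kinv` BY NAME).
* §2 **`nextScale_eq_propagatorForm`** (`d ≥ 3`): for `Q′, A, P` with the displayed actions, `N′ = g·`, and an `ℓ^∞` solution `h` of
  `Q′h = v`, `P(Ah + N′h) = 0`: `(Q′(Ah + N′h))(y₀) = Σ′_y (v(y) + Q′G′ψ⁻(y))·(Q′G′Q′*)⁻¹(y₀,y) + (Q′(N′h))(y₀)` with `ψ⁻ := P(N′h)` —
  i.e. `A h + N′h` IS block-constant with that value ((63) `eq_augInverse_of_solution` + (51)'s two Lagrange-multiplier identities).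
* §3 **`weighted_nextScale_inverse_apriori`** (`d ≥ 3`, `0 ≤ μ < δ_u∕4`; `θ := λK(C_Q(μ) + 2C_G(μ)) < 1`): for ANY response
  `D : ℓ^∞ →L ℓ^∞` with `Q′∘D = 1`, the fibre equation `P(A(Dv) + N′(Dv)) = 0` and (63)'s weighted letter of constant `K`, every
  `u, f ∈ ℓ^∞` with `Q′(A(Du) + N′(Du)) = f` satisfy **`e^{μρ(z)}|u(z)| ≤ (1 − θ)⁻¹·C_Q(μ)·R_f`** whenever `e^{μρ(y)}|f(y)| ≤ R_f` —
  THE NEXT-SCALE PROPAGATOR IS BOUNDED BETWEEN THE WEIGHTED COARSE SPACES, constant = the free block covariance's `C_Q(μ)` up to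
  `(1 − θ)⁻¹`; with (63) §3 it is exponentially localised.

HONEST (what this is NOT).  A-priori only: existence of a solution `u` (invertibility of `R(w)` on `ℓ^∞`) is not claimed here;
constants existential ∕ useless by value; `θ < 1` is a smallness hypothesis on `λ` at the rate `μ` (symbolic; at `μ = 0` it is an
explicit `O(λ)` condition); scalar `ℤ^d` skeleton, whole lattice, not the torus, not the covariant operators ((A3), NC-NE7b-α
UNRULED); the next chart itself (section ∕ fibre inverse at the next level, their decay) is NOT here; nothing of Bałaban's (A1c).
BY-NAME EFFECT ON THE WALL: NONE.  NE7b NOT PRINTED ∕ NOT PROVED; spine PROVED 0∕9; rung (B)+1 on a FINITE torus — NOT infinite volume,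
NOT the mass gap, NOT Clay.  HONEST DEPENDENCY: continuum YM on T⁴ ⇐ BetaPertH ∧ nine spine estimates (0∕9 proved); BetaPertH ⇐ (D1)
∧ (D4) ∧ CAP+tail; G-an2-4 gates asym, D1 and NE2∕3∕4.
-/

set_option autoImplicit false

noncomputable section

namespace Summit.QuantumFields.BalabanUV.T4Continuum.NE7b.SupNextScalePropagator

open scoped ENNReal
open Literature.MathematicalPhysics.QuantumFieldTheory.Balaban1983to89
open B4Sect5Proof (latticeConst latticeConst_nonneg)
open B6QGQLower276 (X blk B mem_B sum_B_const AX kerQGQ)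
open B6QGQDecay237 (deltaU deltaU_pos cU cU_pos cInv cInv_pos deltaInv deltaInv_pos abs_kerQGQ_le_unif)
open B5Hk103ScalarZd (Gk Kinv nbhd deltaH deltaH_pos summable_expX tsum_expX_le tsum_mul_tsum_comm abs_Kinv_le)
open B5QGQInverseL2Zd (tsum_kerQGQ_mul_Kinv)
open B5Hk165L2Zd (HBZd)
open Summit.QuantumFields.BalabanUV.Beta.D1BFx.BlockColumnSupNorm (cHs cHs_nonneg)
open Summit.QuantumFields.BalabanUV.Beta.D1BFx.PointColumnSplit (cKL cG0 cSplit)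
open Summit.QuantumFields.BalabanUV.Beta.D1BFx.PointColumnDecay (cFar)
open BlockPropagatorSupNorm (abs_tsum_Gk_mul_le_sup supConstG_nonneg)
open FibreInverseSupNorm (sum_AX_HBZd sum_AX_fibreInverse summable_mul_Kinv_row abs_blockAvg_le)
open AugmentedSupEquivalence (blockAvg_fibreProj)
open LocalNemytskiiSup (abs_apply_le_norm)
open OneShotChartWeightedRows (weighted_Gop weighted_blockAvg exp_weight_exchange abs_le_exp_neg_mul nonneg_of_weighted)
open SupBackgroundLocalisation (eq_augInverse_of_solution)

variable {d : ℕ}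

/-! ## §1. The block covariance `Q′G′Q′*` on the weighted coarse space; `Q′G′Q′* ∘ (Q′G′Q′*)⁻¹ = 1` on bounded data -/

/-- **THE WEIGHTED LETTER OF THE BLOCK COVARIANCE** (every `d`, `0 ≤ μ < δ_u`): if `e^{μρ(y)}|f(y)| ≤ R` then
`e^{μρ(z)}|Σ′_y (Q′G′Q′*)(z,y)f(y)| ≤ cU·K_d(δ_u − μ)·R` (pv23's mesh-free row decay `abs_kerQGQ_le_unif` + (62)'s exchange).
[folklore] -/
theorem weighted_kerQGQ (n : ℕ) {a : ℝ} (ha : 0 < a) {μ : ℝ} (hμ0 : 0 ≤ μ) (hμ : μ < deltaU d a)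
    {ρ : X d → ℝ} (hρ : ∀ x y, ρ x - ρ y ≤ dist x y) {f : X d → ℝ} {R : ℝ}
    (hf : ∀ y, Real.exp (μ * ρ y) * |f y| ≤ R) (z : X d) :
    Real.exp (μ * ρ z) * |∑' y : X d, kerQGQ n a z y * f y| ≤ cU d a * latticeConst d (deltaU d a - μ) * R := by
  have hR : 0 ≤ R := nonneg_of_weighted (g := id) hf
  have hb : 0 < deltaU d a - μ := sub_pos.2 hμ
  have hE : 0 < Real.exp (μ * ρ z) := Real.exp_pos _
  have hc := (cU_pos d ha).le
  have hmaj : Summable fun y : X d =>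
      cU d a * R * Real.exp (-(μ * ρ z)) * Real.exp (-((deltaU d a - μ) * dist z y)) :=
    (summable_expX hb z).mul_left _
  have hpt : ∀ y : X d, ‖kerQGQ n a z y * f y‖
      ≤ cU d a * R * Real.exp (-(μ * ρ z)) * Real.exp (-((deltaU d a - μ) * dist z y)) := by
    intro y
    rw [Real.norm_eq_abs, abs_mul]
    have h1 := abs_le_exp_neg_mul y (hf y)
    have h2 := abs_kerQGQ_le_unif n ha z y
    have h3 := exp_weight_exchange (b := deltaU d a) hμ0 hρ z y
    calc |kerQGQ n a z y| * |f y|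
        ≤ (cU d a * Real.exp (-(deltaU d a * dist z y))) * (R * Real.exp (-(μ * ρ y))) :=
          mul_le_mul h2 h1 (abs_nonneg _) (by positivity)
      _ = cU d a * R * Real.exp (-(μ * ρ z))
            * (Real.exp (μ * ρ z) * (Real.exp (-(deltaU d a * dist z y)) * Real.exp (-(μ * ρ y)))) := by
          have : Real.exp (-(μ * ρ z)) * Real.exp (μ * ρ z) = 1 := by
            rw [← Real.exp_add, neg_add_cancel, Real.exp_zero]
          calc _ = cU d a * R * 1 * (Real.exp (-(deltaU d a * dist z y)) * Real.exp (-(μ * ρ y))) := by ring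
            _ = _ := by rw [← this]; ring
      _ ≤ _ := mul_le_mul_of_nonneg_left h3 (by positivity)
  have h := tsum_of_norm_bounded hmaj.hasSum hpt
  rw [Real.norm_eq_abs, tsum_mul_left] at h
  have hK := tsum_expX_le hb z
  calc Real.exp (μ * ρ z) * |∑' y : X d, kerQGQ n a z y * f y|
      ≤ Real.exp (μ * ρ z) * (cU d a * R * Real.exp (-(μ * ρ z))
          * ∑' y : X d, Real.exp (-((deltaU d a - μ) * dist z y))) := mul_le_mul_of_nonneg_left h hE.le
    _ = cU d a * R * ∑' y : X d, Real.exp (-((deltaU d a - μ) * dist z y)) := by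
          have : Real.exp (μ * ρ z) * Real.exp (-(μ * ρ z)) = 1 := by
            rw [← Real.exp_add, add_neg_cancel, Real.exp_zero]
          calc _ = (Real.exp (μ * ρ z) * Real.exp (-(μ * ρ z))) * (cU d a * R)
                * ∑' y : X d, Real.exp (-((deltaU d a - μ) * dist z y)) := by ring
            _ = _ := by rw [this, one_mul]
    _ ≤ cU d a * R * latticeConst d (deltaU d a - μ) := mul_le_mul_of_nonneg_left hK (by positivity)
    _ = _ := by ring

/-- **`Q′G′Q′* ∘ (Q′G′Q′*)⁻¹ = 1` ON BOUNDED COARSE DATA**: `Σ′_y (Q′G′Q′*)(z,y)·Σ′_{y′} m(y′)(Q′G′Q′*)⁻¹(y,y′) = m(z)` for `|m| ≤ R`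
(Fubini by `tsum_mul_tsum_comm` with the two exponential row majorants). [folklore] -/
theorem tsum_kerQGQ_Kinv_apply (n : ℕ) {a : ℝ} (ha : 0 < a) {m : X d → ℝ} {R : ℝ} (hm : ∀ y, |m y| ≤ R) (z : X d) :
    ∑' y : X d, kerQGQ n a z y * ∑' y' : X d, m y' * Kinv n a y y' = m z := by
  classical
  have hR : 0 ≤ R := (abs_nonneg _).trans (hm z)
  have hmaj : ∀ y y' : X d, |kerQGQ n a z y * (m y' * Kinv n a y y')|
      ≤ cU d a * cInv d a * R * Real.exp (-(deltaU d a * dist z y)) * Real.exp (-(deltaInv d a * dist y y')) := by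
    intro y y'
    rw [abs_mul, abs_mul]
    have h1 := abs_kerQGQ_le_unif n ha z y
    have h2 := abs_Kinv_le n ha y y'
    have h3 := hm y'
    have hc1 := (cU_pos d ha).le
    have hc2 := (cInv_pos d ha).le
    calc |kerQGQ n a z y| * (|m y'| * |Kinv n a y y'|)
        ≤ (cU d a * Real.exp (-(deltaU d a * dist z y))) * (R * (cInv d a * Real.exp (-(deltaInv d a * dist y y')))) :=
          mul_le_mul h1 (mul_le_mul h3 h2 (abs_nonneg _) hR) (by positivity) (by positivity)
      _ = _ := by ring
  rw [tsum_mul_tsum_comm (C := cU d a * cInv d a * R) (deltaU_pos d ha) (deltaInv_pos d ha) z hmaj]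
  have hinner : ∀ y' : X d, ∑' y : X d, kerQGQ n a z y * (m y' * Kinv n a y y') = (if z = y' then 1 else 0) * m y' := by
    intro y'
    have : ∀ y : X d, kerQGQ n a z y * (m y' * Kinv n a y y') = m y' * (kerQGQ n a z y * Kinv n a y y') := fun y => by ring
    simp_rw [this]
    rw [tsum_mul_left, tsum_kerQGQ_mul_Kinv n ha z y', mul_comm]
  simp_rw [hinner]
  rw [tsum_eq_single z (fun y' hy' => by rw [if_neg (Ne.symm hy'), zero_mul])]
  rw [if_pos rfl, one_mul]

/-! ## §2. The next-scale linearised equation map in propagator form -/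

/-- **THE PROPAGATOR FORM OF THE NEXT-SCALE MAP** (`d ≥ 3`): for `Q′, A, P` with the displayed actions, `N′ = g·` and an `ℓ^∞`
solution `h` of `Q′h = v`, `P(Ah + N′h) = 0`, the fine field `Ah + N′h` is BLOCK-CONSTANT and
`(Q′(Ah + N′h))(y₀) = Σ′_y (v(y) + (Q′G′ψ⁻)(y))·(Q′G′Q′*)⁻¹(y₀,y) + (Q′(N′h))(y₀)`, `ψ⁻ := P(N′h)` — (63)'s `h = T⁻¹(v, −ψ⁻)` composed
with (51)'s multiplier identities `A(Hk) = Q′*((Q′G′Q′*)⁻¹k)`, `A(Γψ) = ψ − Q′*((Q′G′Q′*)⁻¹Q′G′ψ)`. [folklore] -/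
theorem nextScale_eq_propagatorForm (hd : 3 ≤ d) (n : ℕ) {a : ℝ} (ha : 0 < a)
    (Dop Aop Pop Nop : lp (fun _ : X d => ℝ) ∞ →L[ℝ] lp (fun _ : X d => ℝ) ∞)
    (hD : ∀ (f : lp (fun _ : X d => ℝ) ∞) (y : X d), Dop f y = (((n : ℝ) + 1) ^ d)⁻¹ * ∑ p ∈ B n y, f p)
    (hA : ∀ (f : lp (fun _ : X d => ℝ) ∞) (p : X d), Aop f p = ∑ r ∈ nbhd n p, AX n a p r * f r)
    (hP : ∀ (f : lp (fun _ : X d => ℝ) ∞) (p : X d), Pop f p = f p - (((n : ℝ) + 1) ^ d)⁻¹ * ∑ p' ∈ B n (blk n p), f p')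
    (h v : lp (fun _ : X d => ℝ) ∞) (h1 : Dop h = v) (h2 : Pop (Aop h + Nop h) = 0) (y₀ : X d) :
    Dop (Aop h + Nop h) y₀
      = (∑' y : X d, (v y + (((n : ℝ) + 1) ^ d)⁻¹ * ∑ p' ∈ B n y,
            ∑' q : X d, Gk n a p' q * (Pop (Nop h)) q) * Kinv n a y₀ y)
        + Dop (Nop h) y₀ := by
  classical
  have hsd : (0 : ℝ) < ((n : ℝ) + 1) ^ d := by positivity
  -- the solution is the displayed `T⁻¹(v, −P(N′h))`
  have hsol := eq_augInverse_of_solution hd n ha Dop Aop Pop Nop hD hA hP h v 0 (map_zero Dop) h1 h2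
  have hψeq : ((0 : lp (fun _ : X d => ℝ) ∞) - Pop (Nop h) : lp (fun _ : X d => ℝ) ∞)
      = -Pop (Nop h) := zero_sub _
  -- boundedness letters of the data
  have hvb : ∀ y, |v y| ≤ ‖v‖ := fun y => abs_apply_le_norm v y
  have hψb : ∀ q, |((0 : lp (fun _ : X d => ℝ) ∞) - Pop (Nop h)) q| ≤ ‖(0 : lp (fun _ : X d => ℝ) ∞) - Pop (Nop h)‖ :=
    fun q => abs_apply_le_norm _ q
  have hGb := fun p => abs_tsum_Gk_mul_le_sup hd n ha hψb p
  -- `A h` at a site of the block `y₀`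
  have hAh : ∀ p : X d, Aop h p
      = (∑' y : X d, v y * Kinv n a (blk n p) y)
        + (((0 : lp (fun _ : X d => ℝ) ∞) - Pop (Nop h)) p
          - ∑' y : X d, ((((n : ℝ) + 1) ^ d)⁻¹ * ∑ p' ∈ B n y,
              ∑' q : X d, Gk n a p' q * ((0 : lp (fun _ : X d => ℝ) ∞) - Pop (Nop h)) q) * Kinv n a (blk n p) y) := by
    intro p
    rw [hA]
    have e1 : ∑ r ∈ nbhd n p, AX n a p r * h r
        = ∑ r ∈ nbhd n p, AX n a p r * HBZd n a v r
          + ∑ r ∈ nbhd n p, AX n a p r *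
              ((∑' q : X d, Gk n a r q * ((0 : lp (fun _ : X d => ℝ) ∞) - Pop (Nop h)) q)
                - HBZd n a (fun y => (((n : ℝ) + 1) ^ d)⁻¹ * ∑ p' ∈ B n y,
                    ∑' q : X d, Gk n a p' q * ((0 : lp (fun _ : X d => ℝ) ∞) - Pop (Nop h)) q) r) := by
      rw [← Finset.sum_add_distrib]
      exact Finset.sum_congr rfl fun r _ => by rw [hsol r, mul_add]
    rw [e1, sum_AX_HBZd n ha hvb p, sum_AX_fibreInverse n ha hψb hGb p]
  -- `A h + N′h` is block-constant: `−P(N′h) + N′h = (Q′(N′h))∘blk`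
  have eψ : ∀ q : X d, ((0 : lp (fun _ : X d => ℝ) ∞) - Pop (Nop h)) q = -(Pop (Nop h) q) := fun q => by
    rw [lp.coeFn_sub, Pi.sub_apply, lp.coeFn_zero, Pi.zero_apply, zero_sub]
  have eavg : ∀ y : X d, (((n : ℝ) + 1) ^ d)⁻¹ * ∑ p' ∈ B n y,
        ∑' q : X d, Gk n a p' q * ((0 : lp (fun _ : X d => ℝ) ∞) - Pop (Nop h)) q
      = -((((n : ℝ) + 1) ^ d)⁻¹ * ∑ p' ∈ B n y, ∑' q : X d, Gk n a p' q * (Pop (Nop h)) q) := by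
    intro y
    have eG : ∀ p' : X d, ∑' q : X d, Gk n a p' q * ((0 : lp (fun _ : X d => ℝ) ∞) - Pop (Nop h)) q
        = -∑' q : X d, Gk n a p' q * (Pop (Nop h)) q := fun p' => by
      rw [← tsum_neg]; exact tsum_congr fun q => by rw [eψ, mul_neg]
    simp_rw [eG, Finset.sum_neg_distrib, mul_neg]
  have hψb' : ∀ q, |Pop (Nop h) q| ≤ ‖Pop (Nop h)‖ := fun q => abs_apply_le_norm _ q
  have hGb' := fun p => abs_tsum_Gk_mul_le_sup hd n ha hψb' p
  have hfine : ∀ p : X d, (Aop h + Nop h) p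
      = (∑' y : X d, (v y + (((n : ℝ) + 1) ^ d)⁻¹ * ∑ p' ∈ B n y,
            ∑' q : X d, Gk n a p' q * (Pop (Nop h)) q) * Kinv n a (blk n p) y)
        + Dop (Nop h) (blk n p) := by
    intro p
    have hs1 : Summable fun y : X d => v y * Kinv n a (blk n p) y := summable_mul_Kinv_row n ha hvb (blk n p)
    have hs2 : Summable fun y : X d => ((((n : ℝ) + 1) ^ d)⁻¹ * ∑ p' ∈ B n y,
        ∑' q : X d, Gk n a p' q * (Pop (Nop h)) q) * Kinv n a (blk n p) y :=
      summable_mul_Kinv_row n ha (fun y => abs_blockAvg_le n hGb' y) (blk n p)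
    have et : (∑' y : X d, ((((n : ℝ) + 1) ^ d)⁻¹ * ∑ p' ∈ B n y,
          ∑' q : X d, Gk n a p' q * ((0 : lp (fun _ : X d => ℝ) ∞) - Pop (Nop h)) q) * Kinv n a (blk n p) y)
        = -∑' y : X d, ((((n : ℝ) + 1) ^ d)⁻¹ * ∑ p' ∈ B n y,
            ∑' q : X d, Gk n a p' q * (Pop (Nop h)) q) * Kinv n a (blk n p) y := by
      rw [← tsum_neg]; exact tsum_congr fun y => by rw [eavg y, neg_mul]
    have es : (∑' y : X d, (v y + (((n : ℝ) + 1) ^ d)⁻¹ * ∑ p' ∈ B n y,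
          ∑' q : X d, Gk n a p' q * (Pop (Nop h)) q) * Kinv n a (blk n p) y)
        = (∑' y : X d, v y * Kinv n a (blk n p) y)
          + ∑' y : X d, ((((n : ℝ) + 1) ^ d)⁻¹ * ∑ p' ∈ B n y,
              ∑' q : X d, Gk n a p' q * (Pop (Nop h)) q) * Kinv n a (blk n p) y := by
      rw [← hs1.tsum_add hs2]; exact tsum_congr fun y => by ring
    rw [lp.coeFn_add, Pi.add_apply, hAh p, hD (Nop h) (blk n p), eψ p, hP (Nop h) p, et, es]
    ring
  -- average a block-constant function over the block
  rw [hD]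
  have e4 : ∑ p ∈ B n y₀, (Aop h + Nop h) p
      = ∑ p ∈ B n y₀, ((∑' y : X d, (v y + (((n : ℝ) + 1) ^ d)⁻¹ * ∑ p' ∈ B n y,
            ∑' q : X d, Gk n a p' q * (Pop (Nop h)) q) * Kinv n a y₀ y) + Dop (Nop h) y₀) :=
    Finset.sum_congr rfl fun p hp => by rw [hfine p, mem_B.1 hp]
  rw [e4, sum_B_const, ← mul_assoc, inv_mul_cancel₀ hsd.ne', one_mul]

/-! ## §3. The weighted a-priori letter for the next-scale propagator -/

/-- **THE NEXT-SCALE PROPAGATOR IS BOUNDED BETWEEN THE WEIGHTED COARSE SPACES** (`d ≥ 3`, `0 ≤ μ < δ_u∕4`, `ρ` bounded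
with `ρ x − ρ y ≤ |x − y|`; `θ := λ·K·(C_Q(μ) + 2C_G(μ)) < 1`): for ANY response `D : ℓ^∞ →L ℓ^∞` with `Q′(Dv) = v`, the fibre equation
`P(A(Dv) + N′(Dv)) = 0` (`N′ = g·`, `|g| ≤ λ`) and the weighted letter of constant `K` ((63) §4), every `u, f ∈ ℓ^∞` with
`Q′(A(Du) + N′(Du)) = f` satisfy `e^{μρ(z)}|u(z)| ≤ (1 − θ)⁻¹·C_Q(μ)·R_f` whenever `e^{μρ(y)}|f(y)| ≤ R_f`, `C_Q(μ) = cU·K_d(δ_u − μ)`,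
`C_G(μ) = A_G·K_d(δ_u∕4 − μ)` — the inverse of SIS's next equation map's derivative reads its source with exponentially small weight
far away. [folklore] -/
theorem weighted_nextScale_inverse_apriori (hd : 3 ≤ d) (n : ℕ) {a : ℝ} (ha : 0 < a)
    (Dop Aop Pop Nop D : lp (fun _ : X d => ℝ) ∞ →L[ℝ] lp (fun _ : X d => ℝ) ∞)
    (hD : ∀ (f : lp (fun _ : X d => ℝ) ∞) (y : X d), Dop f y = (((n : ℝ) + 1) ^ d)⁻¹ * ∑ p ∈ B n y, f p)
    (hA : ∀ (f : lp (fun _ : X d => ℝ) ∞) (p : X d), Aop f p = ∑ r ∈ nbhd n p, AX n a p r * f r)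
    (hP : ∀ (f : lp (fun _ : X d => ℝ) ∞) (p : X d), Pop f p = f p - (((n : ℝ) + 1) ^ d)⁻¹ * ∑ p' ∈ B n (blk n p), f p')
    {g : X d → ℝ} {lam : ℝ} (hN : ∀ (f : lp (fun _ : X d => ℝ) ∞) (p : X d), Nop f p = g p * f p) (hg : ∀ p, |g p| ≤ lam)
    (hDD : ∀ v : lp (fun _ : X d => ℝ) ∞, Dop (D v) = v)
    (hDfib : ∀ v : lp (fun _ : X d => ℝ) ∞, Pop (Aop (D v) + Nop (D v)) = 0)
    {μ : ℝ} (hμ0 : 0 ≤ μ) (hμU : μ < deltaU d a / 4)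
    {ρ : X d → ℝ} (hρ : ∀ x y, ρ x - ρ y ≤ dist x y) {Mρ : ℝ} (hρb : ∀ y, |ρ y| ≤ Mρ) {K : ℝ}
    (hDwt : ∀ (v : lp (fun _ : X d => ℝ) ∞) (Rv : ℝ), (∀ y, Real.exp (μ * ρ y) * |v y| ≤ Rv) →
      ∀ p : X d, Real.exp (μ * ρ (blk n p)) * |D v p| ≤ K * Rv)
    (hθ : lam * K * (cU d a * latticeConst d (deltaU d a - μ)
        + 2 * (((cG0 d * cKL d (d - 2) + cSplit d a) * Real.exp (2 * deltaU d a)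
            + cFar d a * Real.exp (4 * deltaU d a) / deltaU d a ^ 2) * latticeConst d (deltaU d a / 4 - μ))) < 1)
    (u f : lp (fun _ : X d => ℝ) ∞) (hf : ∀ y, Dop (Aop (D u) + Nop (D u)) y = f y)
    {Rf : ℝ} (hRf : ∀ y, Real.exp (μ * ρ y) * |f y| ≤ Rf) (z : X d) :
    Real.exp (μ * ρ z) * |u z|
      ≤ (1 - lam * K * (cU d a * latticeConst d (deltaU d a - μ)
          + 2 * (((cG0 d * cKL d (d - 2) + cSplit d a) * Real.exp (2 * deltaU d a)
              + cFar d a * Real.exp (4 * deltaU d a) / deltaU d a ^ 2) * latticeConst d (deltaU d a / 4 - μ))))⁻¹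
        * (cU d a * latticeConst d (deltaU d a - μ) * Rf) := by
  haveI : Nonempty (X d) := ⟨fun _ => 0⟩
  have hlam : 0 ≤ lam := (abs_nonneg _).trans (hg 0)
  have hμU' : μ < deltaU d a := by have := deltaU_pos d ha; linarith
  have hCQ : 0 ≤ cU d a * latticeConst d (deltaU d a - μ) :=
    mul_nonneg (cU_pos d ha).le (latticeConst_nonneg d (sub_pos.2 hμU').le)
  have hCG : 0 ≤ ((cG0 d * cKL d (d - 2) + cSplit d a) * Real.exp (2 * deltaU d a)
      + cFar d a * Real.exp (4 * deltaU d a) / deltaU d a ^ 2) * latticeConst d (deltaU d a / 4 - μ) :=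
    mul_nonneg (supConstG_nonneg d ha) (latticeConst_nonneg d (sub_pos.2 hμU).le)
  have hRf0 : 0 ≤ Rf := nonneg_of_weighted (g := id) hRf
  -- the weighted size `U` of `u`
  have hbdd : BddAbove (Set.range fun y : X d => Real.exp (μ * ρ y) * |u y|) := by
    refine ⟨Real.exp (μ * Mρ) * ‖u‖, ?_⟩
    rintro _ ⟨y, rfl⟩
    have h1 : Real.exp (μ * ρ y) ≤ Real.exp (μ * Mρ) :=
      Real.exp_le_exp.2 (mul_le_mul_of_nonneg_left ((le_abs_self _).trans (hρb _)) hμ0)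
    exact mul_le_mul h1 (abs_apply_le_norm u y) (abs_nonneg _) (Real.exp_pos _).le
  obtain ⟨U, hU, hUle⟩ : ∃ U : ℝ, (∀ y, Real.exp (μ * ρ y) * |u y| ≤ U) ∧
      ∀ C : ℝ, (∀ y, Real.exp (μ * ρ y) * |u y| ≤ C) → U ≤ C :=
    ⟨⨆ y : X d, Real.exp (μ * ρ y) * |u y|, fun y => le_ciSup hbdd y, fun C hC => ciSup_le hC⟩
  have hU0 : 0 ≤ U := (mul_nonneg (Real.exp_pos _).le (abs_nonneg _)).trans (hU 0)
  -- the response `h := D u` and its weighted letters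
  have hh : ∀ p, Real.exp (μ * ρ (blk n p)) * |D u p| ≤ K * U := hDwt u U hU
  have hNh : ∀ p, Real.exp (μ * ρ (blk n p)) * |Nop (D u) p| ≤ lam * (K * U) := fun p => by
    rw [hN, abs_mul, mul_left_comm]
    exact mul_le_mul (hg p) (hh p) (mul_nonneg (Real.exp_pos _).le (abs_nonneg _)) hlam
  have hDN : ∀ y, Real.exp (μ * ρ y) * |Dop (Nop (D u)) y| ≤ lam * (K * U) := fun y => by
    rw [hD]; exact weighted_blockAvg n (f := fun p => Nop (D u) p) hNh y
  have hψ : ∀ q, Real.exp (μ * ρ (blk n q)) * |Pop (Nop (D u)) q| ≤ 2 * (lam * (K * U)) := fun q => by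
    have havg := weighted_blockAvg n (μ := μ) (ρ := ρ) (f := fun p => Nop (D u) p) hNh (blk n q)
    have hE : 0 ≤ Real.exp (μ * ρ (blk n q)) := (Real.exp_pos _).le
    rw [hP]
    calc _ ≤ Real.exp (μ * ρ (blk n q)) * (|Nop (D u) q| + |(((n : ℝ) + 1) ^ d)⁻¹ * ∑ p' ∈ B n (blk n q), Nop (D u) p'|) :=
          mul_le_mul_of_nonneg_left (abs_sub _ _) hE
      _ ≤ lam * (K * U) + lam * (K * U) := by rw [mul_add]; exact add_le_add (hNh q) havg
      _ = 2 * (lam * (K * U)) := by ring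
  have hψb : ∀ q, |Pop (Nop (D u)) q| ≤ ‖Pop (Nop (D u))‖ := fun q => abs_apply_le_norm _ q
  have hGψ : ∀ p', Real.exp (μ * ρ (blk n p')) * |∑' q : X d, Gk n a p' q * Pop (Nop (D u)) q|
      ≤ ((cG0 d * cKL d (d - 2) + cSplit d a) * Real.exp (2 * deltaU d a)
          + cFar d a * Real.exp (4 * deltaU d a) / deltaU d a ^ 2) * latticeConst d (deltaU d a / 4 - μ)
        * (2 * (lam * (K * U))) := fun p' => weighted_Gop hd n ha hμ0 hμU hρ hψb hψ p'
  have hQGψ : ∀ y, Real.exp (μ * ρ y) * |(((n : ℝ) + 1) ^ d)⁻¹ * ∑ p' ∈ B n y, ∑' q : X d, Gk n a p' q * Pop (Nop (D u)) q|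
      ≤ ((cG0 d * cKL d (d - 2) + cSplit d a) * Real.exp (2 * deltaU d a)
          + cFar d a * Real.exp (4 * deltaU d a) / deltaU d a ^ 2) * latticeConst d (deltaU d a / 4 - μ)
        * (2 * (lam * (K * U))) := weighted_blockAvg n hGψ
  -- the propagator form at `h = D u`, then one application of `Q′G′Q′*`
  have hform := fun y₀ => nextScale_eq_propagatorForm hd n ha Dop Aop Pop Nop hD hA hP (D u) u (hDD u) (hDfib u) y₀
  have hmb : ∀ y, |u y + (((n : ℝ) + 1) ^ d)⁻¹ * ∑ p' ∈ B n y, ∑' q : X d, Gk n a p' q * Pop (Nop (D u)) q|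
      ≤ ‖u‖ + ((cG0 d * cKL d (d - 2) + cSplit d a) * Real.exp (2 * deltaU d a)
          + cFar d a * Real.exp (4 * deltaU d a) / deltaU d a ^ 2) * latticeConst d (deltaU d a / 4)
            * ‖Pop (Nop (D u))‖ := fun y =>
    (abs_add_le _ _).trans (add_le_add (abs_apply_le_norm u y)
      (abs_blockAvg_le n (fun p' => abs_tsum_Gk_mul_le_sup hd n ha hψb p') y))
  -- weighted sizes of the two terms
  have hsrc : ∀ y, Real.exp (μ * ρ y) * |f y - Dop (Nop (D u)) y| ≤ Rf + lam * (K * U) := fun y => by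
    have hE : 0 ≤ Real.exp (μ * ρ y) := (Real.exp_pos _).le
    calc _ ≤ Real.exp (μ * ρ y) * (|f y| + |Dop (Nop (D u)) y|) := mul_le_mul_of_nonneg_left (abs_sub _ _) hE
      _ ≤ Rf + lam * (K * U) := by rw [mul_add]; exact add_le_add (hRf y) (hDN y)
  -- the bound at every site, then the bootstrap
  have hall : ∀ z' : X d, Real.exp (μ * ρ z') * |u z'|
      ≤ cU d a * latticeConst d (deltaU d a - μ) * (Rf + lam * (K * U))
        + ((cG0 d * cKL d (d - 2) + cSplit d a) * Real.exp (2 * deltaU d a)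
            + cFar d a * Real.exp (4 * deltaU d a) / deltaU d a ^ 2) * latticeConst d (deltaU d a / 4 - μ)
          * (2 * (lam * (K * U))) := by
    intro z'
    have hfix' : u z' = (∑' y : X d, kerQGQ n a z' y * (f y - Dop (Nop (D u)) y))
        - (((n : ℝ) + 1) ^ d)⁻¹ * ∑ p' ∈ B n z', ∑' q : X d, Gk n a p' q * Pop (Nop (D u)) q := by
      have e1 : ∀ y, f y - Dop (Nop (D u)) y
          = ∑' y' : X d, (u y' + (((n : ℝ) + 1) ^ d)⁻¹ * ∑ p' ∈ B n y',
              ∑' q : X d, Gk n a p' q * Pop (Nop (D u)) q) * Kinv n a y y' := fun y => by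
        rw [← hf y, hform y]; ring
      simp_rw [e1]
      rw [tsum_kerQGQ_Kinv_apply n ha hmb z']
      ring
    have hE : 0 ≤ Real.exp (μ * ρ z') := (Real.exp_pos _).le
    rw [hfix']
    calc _ ≤ Real.exp (μ * ρ z') * (|∑' y : X d, kerQGQ n a z' y * (f y - Dop (Nop (D u)) y)|
            + |(((n : ℝ) + 1) ^ d)⁻¹ * ∑ p' ∈ B n z', ∑' q : X d, Gk n a p' q * Pop (Nop (D u)) q|) :=
          mul_le_mul_of_nonneg_left (abs_sub _ _) hE
      _ ≤ _ := by rw [mul_add]; exact add_le_add (weighted_kerQGQ n ha hμ0 hμU' hρ hsrc z') (hQGψ z')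
  have hUb := hUle _ hall
  have hpos : 0 < 1 - lam * K * (cU d a * latticeConst d (deltaU d a - μ)
      + 2 * (((cG0 d * cKL d (d - 2) + cSplit d a) * Real.exp (2 * deltaU d a)
          + cFar d a * Real.exp (4 * deltaU d a) / deltaU d a ^ 2) * latticeConst d (deltaU d a / 4 - μ))) := sub_pos.2 hθ
  have hU' : U ≤ (1 - lam * K * (cU d a * latticeConst d (deltaU d a - μ)
      + 2 * (((cG0 d * cKL d (d - 2) + cSplit d a) * Real.exp (2 * deltaU d a)
          + cFar d a * Real.exp (4 * deltaU d a) / deltaU d a ^ 2) * latticeConst d (deltaU d a / 4 - μ))))⁻¹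
        * (cU d a * latticeConst d (deltaU d a - μ) * Rf) := by
    rw [le_inv_mul_iff₀ hpos]
    nlinarith
  exact (hU z).trans hU'

end Summit.QuantumFields.BalabanUV.T4Continuum.NE7b.SupNextScalePropagator

end
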